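import Summits.QuantumFields.YangMills.Theorems.BalabanUVNodesN12FlatHndHarmonicLetter
import HarnessLib

/-!
# BalabanUVNodes ∕ N12 — (β)♭ FOR THE RECORD's `𝐁_k(Z)`, EVERY `Z`: the two remaining consumer shapes (curve form `X = 0`, positivity form `0 < d²A(e^{sX})|₀`) next to the bilinear
# `N12FlatHndHarmonicLetter.hnondeg_real_flat_hierAxial_Bj_allZ`, and the comparison of letters (L) ⟹ (L♭) (so every `hloop`-theorem of files 6 ∕ 8 is an instance of its `_of_harmonic` twin)

Cell `pub-ymgap` (HUMAN RULINGS D-0062 ∕ D-0149), WIDTH SEAT `pub-ymgap-dag-n12-w3` g2 (node N12 = [B15]; key K1⁷ `stmt-QuantumFields-20542`, `--supports … --as helper`; count-neutral).  THEOREMS ONLY;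
corollaries BY NAME of `N12FlatHndHarmonicLetter.eq_zero_of_fderiv_msChart_one_eq_zero_of_hierAxial_of_harmonic` ∕ `harmonic_Bj`, `N12FlatHndRecordLetters.hcov_Bj`, `N12FlatHndConnLetter.hconn_Bj`,
`N12FlatChartHnd.deriv_deriv_wilsonAction4_expChart_one_nonneg`, `N12FlatFibreNullSpaceDetSet.sum_shift_finset_eq`.

CONTENTS.  §1 ★ `harmonic_of_hloop` — the loop letter (L) of `N12FlatFibreNullSpaceDetSet` IMPLIES the harmonic letter (L♭) of `N12FlatHndHarmonicLetter` (any determining set; the computation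
inside FILE 6's `exists_locConstGauge_of_plaq_eq_zero_of_iterLin_eq_zero_detSet`, isolated), `harmonic_atScale` (sanity: the whole-lattice constraint).  §2 ★★★ `eq_zero_of_fderiv_msChart_one_eq_zero_of_hierAxial_Bj`
(curve form: `X` hierarchically axial for `𝐁_k(Z)`, `DΦ(0)X = 0`, `d²∕ds² A(e^{sX})|₀ = 0` ⟹ `X = 0` — every `Z`), ★★ `deriv_deriv_pos_of_fderiv_msChart_one_eq_zero_of_hierAxial_Bj` (positivity form: `X ≠ 0` ⟹
`0 < d²∕ds² A(e^{sX})|₀` — every `Z`).  Hypotheses throughout: `1 ≤ M₁`, `1 ≤ k ≤ m + K`, cover divisibility `side L M₁ k ∣ sitesPerDir 0`; the `Q`-recursion data; slice membership; `hker`.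

HONEST FRAMING.  Flat configuration only (`U₀ = 1`); REAL statements; the analytic letters (`hker`, the flat second variation), `honto` upstream, the near-flat backgrounds and the complexification
stay displayed ∕ with their owners; nothing of Bałaban's estimates is asserted; N12 NOT discharged; K1⁷ NOT closed; counts unmoved (typed 28∕28 · discharged 5∕27); one finite 𝕋⁴ programme at
fixed ε — R4 closes the conditional rung `BalabanLadder.UV` only; the Yang–Mills mass gap (Clay) is NOT proved by any of this; nothing continuum ∕ ℝ⁴ ∕ OS.
-/

noncomputable section

namespace Summit.QuantumFields.YangMills.BalabanUVNodes.N12FlatHndBjAllZ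

open scoped Matrix.Norms.L2Operator Topology
open Literature.MathematicalPhysics.QuantumFieldTheory.Balaban1983to89
open T4Continuum (T4Family)
open BlockAveragingEMLLinearised (linAvg)
open T4AdjointCovarianceUnitary (lieSU)
open B15DeterminingSets
open B5Eq118OneStroke (iterBlockOf)
open B10Eq27TorusAxialLog (axialT)
open Node00
open Literature.MathematicalPhysics.QuantumFieldTheory.Balaban1983to89.B14.Eq213DetSet (Bj)
open Literature.MathematicalPhysics.QuantumFieldTheory.Balaban1983to89.B14.Eq213MaximalDomains (side)
open N12FlatFibreNullSpaceDetSet (sum_shift_finset_eq)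
open N12FlatChartHnd (deriv_deriv_wilsonAction4_expChart_one_nonneg)
open N12FlatHndHarmonicLetter (harmonic_Bj eq_zero_of_fderiv_msChart_one_eq_zero_of_hierAxial_of_harmonic)

variable {P : Params}

/-! ## §1 The loop letter (L) implies the harmonic letter (L♭) -/

section Letters

variable {n : Type*}

/-- ★ **(L) ⟹ (L♭)** for any determining set read up to level `k`: summing the constrained-bond identities `φ(c₊) − φ(c₋) + L^j·A = 0` over an `e_μ`-invariant nonempty family of constrained
`μ`-bonds at one level telescopes the potential away and leaves `|R|·L^j·A_μ = 0`, so `A_μ = 0` over `ℂ` (the step inside `N12FlatFibreNullSpaceDetSet.exists_locConstGauge_of_plaq_eq_zero_of_iterLin_eq_zero_detSet`,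
isolated: every `hloop`-theorem of that file and of `N12FlatHierAxialHndDetSet` is the `_of_harmonic` theorem of `N12FlatHndHarmonicLetter` at `harmonic_of_hloop`). [cite: Balaban1988Convergent, (2.2) p.255] -/
theorem harmonic_of_hloop (𝔹 : DetSet P) (k : ℕ)
    (hloop : ∀ μ : Fin P.d, ∃ (j : ℕ) (R : Finset (Site P j)), j ≤ k ∧ R.Nonempty ∧ (∀ y ∈ R, y.shift μ ∈ R) ∧
      ∀ y ∈ R, (⟨y, μ⟩ : PBond P j) ∈ bondsOf (𝔹 j))
    (φ₀ : Site P 0 → Matrix n n ℂ) (A : Fin P.d → Matrix n n ℂ)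
    (hk : ∀ j, j ≤ k → ∀ c ∈ bondsOf (𝔹 j), φ₀ (embIter j c.tgt) - φ₀ (embIter j c.src) + (P.L ^ j : ℕ) • A c.dir = 0) (μ : Fin P.d) :
    A μ = 0 := by
  obtain ⟨j, R, hj, hRne, hRsh, hRc⟩ := hloop μ
  have hsum : ∑ y ∈ R, (φ₀ (embIter j ((⟨y, μ⟩ : PBond P j).tgt)) - φ₀ (embIter j y) + (P.L ^ j : ℕ) • A μ) = 0 :=
    Finset.sum_eq_zero fun y hy => hk j hj ⟨y, μ⟩ (hRc y hy)
  rw [Finset.sum_add_distrib, Finset.sum_sub_distrib] at hsum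
  have htgt : ∑ y ∈ R, φ₀ (embIter j ((⟨y, μ⟩ : PBond P j).tgt)) = ∑ y ∈ R, φ₀ (embIter j y) :=
    sum_shift_finset_eq μ R hRsh (fun y => φ₀ (embIter j y))
  rw [htgt, sub_self, zero_add, Finset.sum_const, smul_smul, ← Nat.cast_smul_eq_nsmul ℂ, smul_eq_zero] at hsum
  exact hsum.resolve_left (Nat.cast_ne_zero.mpr (mul_ne_zero (Finset.card_ne_zero.mpr hRne) (pow_ne_zero _ P.L_pos.ne')))

/-- Sanity: the whole-lattice `k`-fold constraint `atScale k` satisfies the harmonic letter (L♭) (via (L), `N12FlatFibreNullSpaceDetSet.hloop_atScale`). [cite: Balaban1988Convergent, (2.2) p.255] -/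
theorem harmonic_atScale (k : ℕ) (φ₀ : Site P 0 → Matrix n n ℂ) (A : Fin P.d → Matrix n n ℂ)
    (hk : ∀ j, j ≤ k → ∀ c ∈ bondsOf ((atScale k : DetSet P) j), φ₀ (embIter j c.tgt) - φ₀ (embIter j c.src) + (P.L ^ j : ℕ) • A c.dir = 0) (μ : Fin P.d) :
    A μ = 0 :=
  harmonic_of_hloop (atScale k) k (N12FlatFibreNullSpaceDetSet.hloop_atScale k) φ₀ A hk μ

end Letters

/-! ## §2 (β)♭ for `𝐁_k(Z)`, every `Z`: curve form and positivity form -/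

section Forms

variable {F : T4Family} {N : ℕ} [NeZero N] {K k : ℕ} {M₁ : ℕ} {Z : Set (Site (F.P K) 0)}

/-- ★★★ **(β)♭ AT NODE 00's FLAT CHART ON THE `𝐁_k(Z)`-ADAPTED HIERARCHICAL AXIAL SLICE, EVERY `Z`, CURVE FORM**: `X` hierarchically axial for `Bj M₁ Z k`, `DΦ(0)X = 0`, `d²∕ds² A(e^{sX})|₀ = 0` ⟹ `X = 0`
— `N12FlatHndHarmonicLetter.eq_zero_of_fderiv_msChart_one_eq_zero_of_hierAxial_of_harmonic` with (L♭) ← `harmonic_Bj`, (Cov) ← `hcov_Bj`, (C) ← `hconn_Bj`.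
[cite: Balaban1989LargeFieldII, (1.9) p.358, p.359; Balaban1985RegularSpaces, (1.19) p.79; Balaban1988Convergent, (2.2) p.255, (2.13) pp.256-257] -/
theorem eq_zero_of_fderiv_msChart_one_eq_zero_of_hierAxial_Bj (hk : k ≤ (F.P K).m + (F.P K).K) (hk1 : 1 ≤ k) (hM : 1 ≤ M₁)
    (hdiv : side (F.P K).L M₁ k ∣ (F.P K).sitesPerDir 0)
    (Q : (i : ℕ) → (PBond (F.P K) 0 → Matrix (Fin N) (Fin N) ℂ) → PBond (F.P K) i → Matrix (Fin N) (Fin N) ℂ)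
    (hQ0 : ∀ Y, Q 0 Y = Y) (hQs : ∀ (i : ℕ) (Y : PBond (F.P K) 0 → Matrix (Fin N) (Fin N) ℂ) (c : PBond (F.P K) (i + 1)), Q (i + 1) Y c = linAvg (Q i Y) c)
    {X : PBond (F.P K) 0 → lieSU (Fin N)}
    (hax : ∀ j, j ≤ k → ∀ y ∈ (Bj M₁ Z k : DetSet (F.P K)) j, ∀ m, m < j → ∀ x : Site (F.P K) m, iterBlockOf j (embIter m x) = y →
      axialT (fun b : PBond (F.P K) m => Multiplicative.ofAdd (Q m (fun e => (X e : Matrix (Fin N) (Fin N) ℂ)) b)) (emb (blockOf x)) x = 1)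
    (hker : fderiv ℝ (msChart F N K k (Bj M₁ Z k) (avgFamily (avOfRecord F N K) (1 : GaugeField (F.P K) 0 (SU N))) (1 : GaugeField (F.P K) 0 (SU N))) 0 X = 0)
    (hflat : deriv (deriv fun s : ℝ => wilsonAction4 (expChart (1 : GaugeField (F.P K) 0 (SU N)) (s • X))) 0 = 0) :
    X = 0 :=
  eq_zero_of_fderiv_msChart_one_eq_zero_of_hierAxial_of_harmonic hk Q hQ0 hQs (Bj M₁ Z k) (harmonic_Bj hM hk1 hk hdiv)
    (N12FlatHndRecordLetters.hcov_Bj hM hk1 hk hdiv) (N12FlatHndConnLetter.hconn_Bj hM hk1 hk hdiv) hax hker hflat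

/-- ★★ **POSITIVITY FORM, `𝐁_k(Z)`, EVERY `Z`**: a nonzero hierarchically axial `X` with `DΦ(0)X = 0` has `0 < d²∕ds² A(e^{sX})|₀` (the flat second variation is nonnegative,
`N12FlatChartHnd.deriv_deriv_wilsonAction4_expChart_one_nonneg`, and vanishes only at `X = 0` by the curve form). [cite: Balaban1989LargeFieldII, (1.9) p.358, p.359; Balaban1985RegularSpaces, (1.19) p.79] -/
theorem deriv_deriv_pos_of_fderiv_msChart_one_eq_zero_of_hierAxial_Bj (hk : k ≤ (F.P K).m + (F.P K).K) (hk1 : 1 ≤ k) (hM : 1 ≤ M₁)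
    (hdiv : side (F.P K).L M₁ k ∣ (F.P K).sitesPerDir 0)
    (Q : (i : ℕ) → (PBond (F.P K) 0 → Matrix (Fin N) (Fin N) ℂ) → PBond (F.P K) i → Matrix (Fin N) (Fin N) ℂ)
    (hQ0 : ∀ Y, Q 0 Y = Y) (hQs : ∀ (i : ℕ) (Y : PBond (F.P K) 0 → Matrix (Fin N) (Fin N) ℂ) (c : PBond (F.P K) (i + 1)), Q (i + 1) Y c = linAvg (Q i Y) c)
    {X : PBond (F.P K) 0 → lieSU (Fin N)} (hX0 : X ≠ 0)
    (hax : ∀ j, j ≤ k → ∀ y ∈ (Bj M₁ Z k : DetSet (F.P K)) j, ∀ m, m < j → ∀ x : Site (F.P K) m, iterBlockOf j (embIter m x) = y →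
      axialT (fun b : PBond (F.P K) m => Multiplicative.ofAdd (Q m (fun e => (X e : Matrix (Fin N) (Fin N) ℂ)) b)) (emb (blockOf x)) x = 1)
    (hker : fderiv ℝ (msChart F N K k (Bj M₁ Z k) (avgFamily (avOfRecord F N K) (1 : GaugeField (F.P K) 0 (SU N))) (1 : GaugeField (F.P K) 0 (SU N))) 0 X = 0) :
    0 < deriv (deriv fun s : ℝ => wilsonAction4 (expChart (1 : GaugeField (F.P K) 0 (SU N)) (s • X))) 0 :=
  lt_of_le_of_ne (deriv_deriv_wilsonAction4_expChart_one_nonneg X) fun h =>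
    hX0 (eq_zero_of_fderiv_msChart_one_eq_zero_of_hierAxial_Bj hk hk1 hM hdiv Q hQ0 hQs hax hker h.symm)

end Forms

end Summit.QuantumFields.YangMills.BalabanUVNodes.N12FlatHndBjAllZ

end
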